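import Mathlib.RingTheory.MvPolynomial.Homogeneous
import HarnessLib

/-!
# Bihomogeneity bookkeeping for coefficients of polynomials over a polynomial ring

For a field `k` and `P ∈ (k[y])[s] = MvPolynomial σ (MvPolynomial τ k)` we say (unbundled, as a
plain conjunction, to avoid a definition) that `P` is *bihomogeneous of total degree `n`* if its
coefficient at every `s`-monomial `s^α` is a form of degree `n - |α|` in `y` and vanishes when
`|α| > n`. This file proves the closure properties of that condition — constants, variables,
sums, products, powers (`isBihom_C_C`, `isBihom_X`, `isBihom_C_of_isHomogeneous_one`,
`isBihom_add`, `isBihom_sum`, `isBihom_mul`, `isBihom_prod`, `isBihom_pow`) — and the one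
consequence used downstream: **substituting bihomogeneous elements of degree `1` (e.g. the linear
forms `Σ_j c_j s_j + y_m`) into a form of degree `d` gives a bihomogeneous polynomial of degree
`d`** (`isBihom_aeval`), together with the scaling rule `φ(t • x) = tⁿ φ(x)` for forms
(`eval_smul_of_isHomogeneous`). Consumer: the greedy construction of linear subspaces on cubic
hypersurfaces, `Literature/RingTheory/MvPolynomial/CubicFormLinearSubspaces.lean`.

Mathlib has `MvPolynomial.IsHomogeneous` with `IsHomogeneous.mul/sum/prod/aeval` and the
coefficient formula `MvPolynomial.coeff_mul` (antidiagonal sum), on which everything here rests;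
it has no bigraded bookkeeping for `MvPolynomial σ (MvPolynomial τ R)` (searched: `sumAlgEquiv`
has no coefficient lemmas beyond `C`/`X`). [folklore]
-/

noncomputable section

open _root_.MvPolynomial

namespace Literature.RingTheory.MvPolynomial

universe u

variable {k : Type u} [Field k]

/-! ### Homogeneous polynomials under scaling of the argument -/

/-- `φ(t • x) = t ^ n * φ(x)` for a form `φ` of degree `n`. [folklore] -/
theorem eval_smul_of_isHomogeneous {σ : Type*} {φ : MvPolynomial σ k} {n : ℕ}
    (hφ : φ.IsHomogeneous n) (t : k) (x : σ → k) :
    eval (t • x) φ = t ^ n * eval x φ := by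
  classical
  rw [φ.as_sum, map_sum, map_sum, Finset.mul_sum]
  refine Finset.sum_congr rfl fun d hd => ?_
  simp only [eval_monomial, Pi.smul_apply, smul_eq_mul, mul_pow, Finsupp.prod,
    Finset.prod_mul_distrib]
  rw [Finset.prod_pow_eq_pow_sum, ← hφ.degree_eq_sum_deg_support hd]
  ring

/-! ### Bihomogeneity bookkeeping in `(k[y])[s]` -/

section Bihom

variable {σ τ : Type*}

-- `P` is *bihomogeneous of total degree `n`*:
--   `∀ α, (coeff α P).IsHomogeneous (n - α.degree) ∧ (n < α.degree → coeff α P = 0)`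

/-- Constants `C (C c)` are bihomogeneous of degree `0` (indeed of any degree in the first
clause; we record degree `0`). [folklore] -/
theorem isBihom_C_C (c : k) :
    ∀ α : σ →₀ ℕ, (coeff α (C (C c) : MvPolynomial σ (MvPolynomial τ k))).IsHomogeneous
      (0 - α.degree) ∧ (0 < α.degree → coeff α (C (C c) : MvPolynomial σ (MvPolynomial τ k)) = 0) := by
  classical
  intro α
  rw [coeff_C]
  split_ifs with h
  · subst h
    simp only [map_zero, lt_self_iff_false, IsEmpty.forall_iff, and_true, tsub_zero]
    exact isHomogeneous_C _ _
  · exact ⟨isHomogeneous_zero _ _ _, fun _ => rfl⟩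

/-- An `s`-variable `X j` is bihomogeneous of degree `1`. [folklore] -/
theorem isBihom_X (j : σ) :
    ∀ α : σ →₀ ℕ, (coeff α (X j : MvPolynomial σ (MvPolynomial τ k))).IsHomogeneous
      (1 - α.degree) ∧ (1 < α.degree → coeff α (X j : MvPolynomial σ (MvPolynomial τ k)) = 0) := by
  classical
  intro α
  rw [coeff_X]
  split_ifs with h
  · subst h
    simp only [Finsupp.degree_single, lt_self_iff_false, IsEmpty.forall_iff, and_true, tsub_self]
    exact isHomogeneous_one _ _
  · exact ⟨isHomogeneous_zero _ _ _, fun _ => rfl⟩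

/-- A `y`-linear form `C ℓ`, `ℓ` a form of degree `1`, is bihomogeneous of degree `1`. [folklore] -/
theorem isBihom_C_of_isHomogeneous_one {ℓ : MvPolynomial τ k} (hℓ : ℓ.IsHomogeneous 1) :
    ∀ α : σ →₀ ℕ, (coeff α (C ℓ : MvPolynomial σ (MvPolynomial τ k))).IsHomogeneous
      (1 - α.degree) ∧ (1 < α.degree → coeff α (C ℓ : MvPolynomial σ (MvPolynomial τ k)) = 0) := by
  classical
  intro α
  rw [coeff_C]
  split_ifs with h
  · subst h
    exact ⟨by simpa using hℓ, fun h => absurd h (by simp)⟩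
  · exact ⟨isHomogeneous_zero _ _ _, fun _ => rfl⟩

/-- Bihomogeneous polynomials of the same degree are closed under addition. [folklore] -/
theorem isBihom_add {n : ℕ} {P Q : MvPolynomial σ (MvPolynomial τ k)}
    (hP : ∀ α, (coeff α P).IsHomogeneous (n - α.degree) ∧ (n < α.degree → coeff α P = 0))
    (hQ : ∀ α, (coeff α Q).IsHomogeneous (n - α.degree) ∧ (n < α.degree → coeff α Q = 0)) :
    ∀ α, (coeff α (P + Q)).IsHomogeneous (n - α.degree) ∧ (n < α.degree → coeff α (P + Q) = 0) := by
  intro α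
  rw [coeff_add]
  exact ⟨(hP α).1.add (hQ α).1, fun h => by rw [(hP α).2 h, (hQ α).2 h, add_zero]⟩

/-- Bihomogeneous polynomials are closed under finite sums. [folklore] -/
theorem isBihom_sum {n : ℕ} {ι : Type*} (s : Finset ι) (P : ι → MvPolynomial σ (MvPolynomial τ k))
    (hP : ∀ i ∈ s, ∀ α, (coeff α (P i)).IsHomogeneous (n - α.degree) ∧
      (n < α.degree → coeff α (P i) = 0)) :
    ∀ α, (coeff α (∑ i ∈ s, P i)).IsHomogeneous (n - α.degree) ∧
      (n < α.degree → coeff α (∑ i ∈ s, P i) = 0) := by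
  classical
  induction s using Finset.induction_on with
  | empty =>
    intro α
    rw [Finset.sum_empty, coeff_zero]
    exact ⟨isHomogeneous_zero _ _ _, fun _ => rfl⟩
  | insert i s hi ih =>
    rw [Finset.sum_insert hi]
    exact isBihom_add (hP i (Finset.mem_insert_self i s))
      (ih fun j hj => hP j (Finset.mem_insert_of_mem hj))

/-- Bihomogeneous polynomials multiply: degrees add. [folklore] -/
theorem isBihom_mul {m n : ℕ} {P Q : MvPolynomial σ (MvPolynomial τ k)}
    (hP : ∀ α, (coeff α P).IsHomogeneous (m - α.degree) ∧ (m < α.degree → coeff α P = 0))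
    (hQ : ∀ α, (coeff α Q).IsHomogeneous (n - α.degree) ∧ (n < α.degree → coeff α Q = 0)) :
    ∀ α, (coeff α (P * Q)).IsHomogeneous (m + n - α.degree) ∧
      (m + n < α.degree → coeff α (P * Q) = 0) := by
  classical
  intro γ
  rw [coeff_mul]
  refine ⟨IsHomogeneous.sum _ _ _ fun x hx => ?_, fun hγ => Finset.sum_eq_zero fun x hx => ?_⟩
  · have hsum : x.1 + x.2 = γ := Finset.mem_antidiagonal.mp hx
    by_cases h1 : m < x.1.degree
    · rw [(hP x.1).2 h1, zero_mul]; exact isHomogeneous_zero _ _ _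
    by_cases h2 : n < x.2.degree
    · rw [(hQ x.2).2 h2, mul_zero]; exact isHomogeneous_zero _ _ _
    have hdeg : γ.degree = x.1.degree + x.2.degree := by rw [← hsum, map_add]
    have : m + n - γ.degree = (m - x.1.degree) + (n - x.2.degree) := by omega
    rw [this]
    exact (hP x.1).1.mul (hQ x.2).1
  · have hsum : x.1 + x.2 = γ := Finset.mem_antidiagonal.mp hx
    have hdeg : γ.degree = x.1.degree + x.2.degree := by rw [← hsum, map_add]
    by_cases h1 : m < x.1.degree
    · rw [(hP x.1).2 h1, zero_mul]
    · have h2 : n < x.2.degree := by omega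
      rw [(hQ x.2).2 h2, mul_zero]

/-- Bihomogeneous polynomials are closed under finite products: degrees add. [folklore] -/
theorem isBihom_prod {ι : Type*} (s : Finset ι) (P : ι → MvPolynomial σ (MvPolynomial τ k))
    (n : ι → ℕ)
    (hP : ∀ i ∈ s, ∀ α, (coeff α (P i)).IsHomogeneous (n i - α.degree) ∧
      (n i < α.degree → coeff α (P i) = 0)) :
    ∀ α, (coeff α (∏ i ∈ s, P i)).IsHomogeneous ((∑ i ∈ s, n i) - α.degree) ∧
      ((∑ i ∈ s, n i) < α.degree → coeff α (∏ i ∈ s, P i) = 0) := by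
  classical
  induction s using Finset.induction_on with
  | empty =>
    simpa only [Finset.prod_empty, Finset.sum_empty, ← C_1 (σ := σ), ← C_1 (σ := τ)] using
      isBihom_C_C (σ := σ) (τ := τ) (1 : k)
  | insert i s hi ih =>
    rw [Finset.prod_insert hi, Finset.sum_insert hi]
    exact isBihom_mul (hP i (Finset.mem_insert_self i s))
      (ih fun j hj => hP j (Finset.mem_insert_of_mem hj))

/-- Powers of a bihomogeneous polynomial. [folklore] -/
theorem isBihom_pow {n : ℕ} {P : MvPolynomial σ (MvPolynomial τ k)}
    (hP : ∀ α, (coeff α P).IsHomogeneous (n - α.degree) ∧ (n < α.degree → coeff α P = 0))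
    (e : ℕ) :
    ∀ α, (coeff α (P ^ e)).IsHomogeneous (n * e - α.degree) ∧ (n * e < α.degree → coeff α (P ^ e) = 0) := by
  have h := isBihom_prod (Finset.range e) (fun _ => P) (fun _ => n) fun _ _ => hP
  simp only [Finset.prod_const, Finset.card_range, Finset.sum_const, smul_eq_mul] at h
  rwa [mul_comm] at h

/-- **Substituting bihomogeneous elements of degree `1` into a form of degree `d` gives a
bihomogeneous polynomial of degree `d`.** [folklore] -/
theorem isBihom_aeval {ρ : Type*} {F : MvPolynomial ρ k} {d : ℕ} (hF : F.IsHomogeneous d)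
    (ℓ : ρ → MvPolynomial σ (MvPolynomial τ k))
    (hℓ : ∀ r α, (coeff α (ℓ r)).IsHomogeneous (1 - α.degree) ∧ (1 < α.degree → coeff α (ℓ r) = 0)) :
    ∀ α, (coeff α (aeval ℓ F)).IsHomogeneous (d - α.degree) ∧
      (d < α.degree → coeff α (aeval ℓ F) = 0) := by
  classical
  rw [aeval_def, eval₂_eq]
  refine isBihom_sum _ _ fun e he => ?_
  have hprod := isBihom_prod e.support (fun i => ℓ i ^ e i) (fun i => e i)
    fun i _ => by simpa using isBihom_pow (hℓ i) (e i)
  have hsum : ∑ i ∈ e.support, e i = d := (hF.degree_eq_sum_deg_support he).symm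
  rw [hsum] at hprod
  have halg : (algebraMap k (MvPolynomial σ (MvPolynomial τ k))) (coeff e F) = C (C (coeff e F)) := rfl
  rw [halg]
  simpa using isBihom_mul (isBihom_C_C (σ := σ) (τ := τ) (coeff e F)) hprod

end Bihom

end Literature.RingTheory.MvPolynomial

end
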